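import Literature.Algebra.Lie.Sl2QuotientGraphs
import Literature.Geometry.Kaehler.ComplexTorusHodgeGeneralAbelianSurfacesProduct
import Literature.Geometry.Kaehler.ComplexTorusHodgeGroupProductDimensionCriterion
import Literature.Geometry.Kaehler.ComplexTorusHodgeGroupProductLieKernels
import Literature.Geometry.Kaehler.ComplexTorusMumfordTateComplexLieAlgebraRatForm
import Literature.Geometry.Kaehler.ComplexTorusHodgeGroupLieAlgebraAlgebraic
import Literature.Geometry.Kaehler.ComplexTorusEndomorphismAlgebraProduct
import Literature.NumberTheory.Automorphic.LieAlgebraGLDimension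
import HarnessLib

/-!
# `X₁ × X₂` when both Hodge Lie algebras are products of `𝔰𝔩₂`'s read on standard planes: the Hodge group splits, or a non-zero
# `𝔤`-equivariant map `V₁,ℂ ⇄ V₂,ℂ` exists (`Hom_ℚ(X₁, X₂) ≠ 0` or `Hom_ℚ(X₂, X₁) ≠ 0`) — Moonen–Zarhin (3.1)/(3.3)/(3.4) for
# `𝔰𝔩₂`-isotypic factors, MATRIX FORM

Lane `lit-hodgefound`, seat p17, generation 52, self-proposed row g52-#5 — the CONSUMER of g52-#4 (`Sl2QuotientGraphs`) in the
programme «Moonen–Zarhin Thm. (0.1)(4) for `X ∼ Y₁ × Y₂`», written for ARBITRARY complex tori `X₁`, `X₂` whose complex Hodge Lie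
algebras `𝔤ₖ = Lie Hg(Xₖ)(ℂ)` are given «plane data»: finitely many planes `U ⊆ V_{k,ℂ}` in coordinates `P_U ∈ M_{ι×2}(ℂ)`,
`Q_U ∈ M_{2×ι}(ℂ)` (`Q_U P_U = 1`) which are `𝔤ₖ`-stable together with a stable complement (`Z P_U = P_U ρ_U(Z)`,
`Q_U Z = ρ_U(Z) Q_U`, `ρ_U(Z) = Q_U Z P_U`), on which `𝔤ₖ` acts tracelessly, jointly faithfully, and jointly onto `∏_U 𝔰𝔩₂` — the
situation of a simple abelian surface of type I(2) (`V_ℂ = V_σ ⊕ V_τ`, `𝔤 = 𝔰𝔩(V_σ) × 𝔰𝔩(V_τ)`) or II(1) (`V_ℂ = St ⊗ ℂ²`, `𝔤 = 𝔰𝔩₂ ⊗ 1`);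
the instances are the business of the sequel.  THEOREMS ONLY (no definition, no instance, no notation, no named fact; D-0026 net debt 0).

## The argument (Moonen–Zarhin §3 (3.1), proof of (3.3), (3.4); Hazama's Thm. (3.2)(1) for these factors)

`𝔤 = Lie Hg(X₁ × X₂)(ℂ) ⊆ 𝔤₁ × 𝔤₂` projects onto both factors (`exists_lieHom_toBlocks`), so every plane `U` of either factor gives
a surjection `ρ_U : 𝔤 ↠ 𝔰𝔩₂`.  By g52-#4 (`Sl2Graph.ker_le_or_ker_le_or_forall_exists`, `forall_exists_apply_eq_of_pairwise_univ`):
EITHER some plane `U` of `X₁` and some plane `U'` of `X₂` have comparable kernels — then `ρ_{U'} = Ad(g) ∘ ρ_U` on `𝔤`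
(`Sl2Graph.exists_intertwiner_of_ker_le`, «every automorphism of `𝔰𝔩₂` is inner») and `T = P_{U'} g Q_U : V₁,ℂ → V₂,ℂ` is a
non-zero matrix with `Z₂₂ T = T Z₁₁` for all `Z ∈ 𝔤`, so `(0 0; T 0) ∈ End(V_ℂ)^𝔤 = End_ℚ(X₁ × X₂) ⊗ ℂ`
(`forall_hodgeGroupComplexLie_comm_iff_mem_span_endAlgRat`) has a non-zero `Hom_ℚ(X₁, X₂)`-block (`mem_endAlgRat_prod_iff`) —
OR all cross pairs are incomparable, and then `(ρ_U)_U : 𝔤 ↠ ∏ 𝔰𝔩₂` is onto, which puts `(W 0; 0 0) ∈ 𝔤` for every `W ∈ 𝔤₁`,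
i.e. `Lie K₁ = 𝔤₁` and `Hg(X₁ × X₂) = Hg(X₁) × Hg(X₂)` («`𝔤₃ = 0`»; the tree's dimension criterion).

## Sources, verbatim

* B. Moonen, Yu. G. Zarhin [MoonenZarhin1999LowDim], held `paper:arxiv-math_9901113`: §3 (3.1) (p0006 L25–L51: «`𝔥𝔤(X₁ × X₂) ≅
  𝔤₁ ⊕ 𝔤₂ ⊕ Γ_φ` […] (I.e., `𝔤₃ ≠ 0` in the above.)»); Thm. (3.2)(1) (Hazama) (p0006 L70–L74: «Suppose `X₁` and `X₂` contain no
  factors of Type IV. Then `X₁ × X₂` again satisfies (D), and either `Hom(X₁, X₂) ≠ 0` or `Hg(X₁ × X₂) = Hg(X₁) × Hg(X₂)`»);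
  proof of (3.3) (p0006 L110–L129: «`V_X ⊗_ℚ ℂ ≅ U_1^d ⊕ ⋯ ⊕ U_e^d` as `𝔥𝔤(X)_ℂ`-modules […] `𝔥𝔤(X)_ℂ` acts on each of the summands
  `U_j^d` through `𝔰𝔩(U_j^d)` […] some multiple of `φ` corresponds to an isogeny»); Lemma (3.4) (p0006 L133–L138).
* H. Lange [Lange2023AbelianVarietiesComplex], §7.2.4 Exercise (3) («`End_ℚ(X) = End_{Hg(X)}(H_1(X,ℚ))`»), §1.1.2 Prop. 1.1.6.
* N. Jacobson [Jacobson1962LieAlgebras], Ch. IX §5 Thm. 5; N. Bourbaki [Bourbaki2008LieGroups79], Ch. I §1 no. 8 Cor. 1 of Prop. 7.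

## What is proved

* §1 **`homRat_ne_bot_of_forall_toBlocks₂₂_mul_eq`** (+ mirror `…toBlocks₁₁…`): a non-zero matrix `T : V₁,ℂ → V₂,ℂ` with
  `Z₂₂ T = T Z₁₁` for all `Z ∈ Lie Hg(X₁ × X₂)(ℂ)` forces `Hom_ℚ(X₁, X₂) ≠ 0` (any complex tori).
* §2 **`hodgeGroupC_prod_eq_blockDiagProd_of_forall_fromBlocks_zero_mem`**: `(W 0; 0 0) ∈ Lie Hg(X₁ × X₂)(ℂ)` for all
  `W ∈ Lie Hg(X₁)(ℂ)` ⟹ the Hodge group splits (complex form of the tree's rational criterion).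
* §3 **`hodgeGroupC_prod_eq_blockDiagProd_or_homRat_ne_bot_of_sl2Planes`** — the dichotomy above from plane data on both factors.

## References

* [MoonenZarhin1999LowDim] B. Moonen, Yu. G. Zarhin, Math. Ann. 315 (1999), §3 (3.1), Thm. (3.2), Lemma (3.3)–(3.4) (arXiv v2 = Math. Ann. numbering: Lemma (3.3) = chunk p0006 L84–L131, Lemma (3.4) = p0006 L133–p0007 L7; earlier tree copies of this family wrote «(3.4)»∕«(3.5)» for these two lemmas).
* [Lange2023AbelianVarietiesComplex] H. Lange, *Abelian Varieties over the Complex Numbers* (2023), §1.1.2, §7.2.4.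
* [Jacobson1962LieAlgebras] N. Jacobson, *Lie Algebras* (1962), Ch. IX §5.  [Bourbaki2008LieGroups79] N. Bourbaki, *Lie Groups and Lie Algebras*, Ch. I §1.8.
* [Gordon1997] B. B. Gordon, *A survey of the Hodge conjecture for abelian varieties*, §2.16 Proposition (Goursat).
-/

noncomputable section

open Matrix Module

namespace Literature.Geometry.Kaehler

namespace ComplexTorus

open Literature.NumberTheory.Automorphic (lieAlgebraGL lieSubalgebraGL lie_mem_lieAlgebraGL identityComponent
  lieAlgebraGL_identityComponent isZConnected_identityComponent)
open Literature.Algebra.Lie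

/-! ### §0 Matrix helpers (file-local) -/

section Helpers

variable {R : Type*} [CommRing R] {m m' n : Type*} [Fintype m] [Fintype m'] [Fintype n]

/-- Reading a bracket on a stable plane: `B P = P (QBP)` ⟹ `Q(AB − BA)P = (QAP)(QBP) − (QBP)(QAP)` (with `A P = P (QAP)` too). [folklore] -/
private theorem conj_bracket_of_stable₁₃₃ {P : Matrix m n R} {Q : Matrix n m R} {A B : Matrix m m R}
    (hA : A * P = P * (Q * A * P)) (hB : B * P = P * (Q * B * P)) :
    Q * (A * B - B * A) * P = Q * A * P * (Q * B * P) - Q * B * P * (Q * A * P) := by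
  have h₁ : Q * (A * B) * P = Q * A * P * (Q * B * P) := by
    calc Q * (A * B) * P = Q * A * (B * P) := by simp only [Matrix.mul_assoc]
      _ = Q * A * (P * (Q * B * P)) := by rw [hB]
      _ = Q * A * P * (Q * B * P) := by simp only [Matrix.mul_assoc]
  have h₂ : Q * (B * A) * P = Q * B * P * (Q * A * P) := by
    calc Q * (B * A) * P = Q * B * (A * P) := by simp only [Matrix.mul_assoc]
      _ = Q * B * (P * (Q * A * P)) := by rw [hA]
      _ = Q * B * P * (Q * A * P) := by simp only [Matrix.mul_assoc]
  rw [Matrix.mul_sub, Matrix.sub_mul, h₁, h₂]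

omit [Fintype n] in
/-- `[(A₁ 0; 0 A₂), (B₁ 0; 0 B₂)] = ([A₁,B₁] 0; 0 [A₂,B₂])`, read off on the diagonal blocks. [folklore] -/
private theorem toBlocks_diag_bracket₁₃₃ {A B : Matrix (m ⊕ m') (m ⊕ m') R} {A₁ B₁ : Matrix m m R} {A₂ B₂ : Matrix m' m' R}
    (hA : A = fromBlocks A₁ 0 0 A₂) (hB : B = fromBlocks B₁ 0 0 B₂) :
    (A * B - B * A).toBlocks₁₁ = A₁ * B₁ - B₁ * A₁ ∧ (A * B - B * A).toBlocks₂₂ = A₂ * B₂ - B₂ * A₂ := by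
  have h : A * B - B * A = fromBlocks (A₁ * B₁ - B₁ * A₁) 0 0 (A₂ * B₂ - B₂ * A₂) := by
    rw [hA, hB, Matrix.fromBlocks_multiply, Matrix.fromBlocks_multiply, sub_eq_add_neg, Matrix.fromBlocks_neg,
      Matrix.fromBlocks_add]
    simp [sub_eq_add_neg]
  rw [h, Matrix.toBlocks_fromBlocks₁₁, Matrix.toBlocks_fromBlocks₂₂]
  exact ⟨rfl, rfl⟩

omit [Fintype n] in
/-- `A₂ T = T A₁ ⟹ (A₁ 0; 0 A₂)` commutes with `(0 0; T 0)`. [folklore] -/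
private theorem fromBlocks_diag_comm_lowerLeft₁₃₃ {A₁ : Matrix m m R} {A₂ : Matrix m' m' R} {T : Matrix m' m R}
    (h : A₂ * T = T * A₁) :
    fromBlocks A₁ 0 0 A₂ * fromBlocks 0 0 T 0 = fromBlocks 0 0 T 0 * fromBlocks A₁ 0 0 A₂ := by
  rw [Matrix.fromBlocks_multiply, Matrix.fromBlocks_multiply]
  simp [h]

omit [Fintype n] in
/-- `A₁ T = T A₂ ⟹ (A₁ 0; 0 A₂)` commutes with `(0 T; 0 0)`. [folklore] -/
private theorem fromBlocks_diag_comm_upperRight₁₃₃ {A₁ : Matrix m m R} {A₂ : Matrix m' m' R} {T : Matrix m m' R}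
    (h : A₁ * T = T * A₂) :
    fromBlocks A₁ 0 0 A₂ * fromBlocks 0 T 0 0 = fromBlocks 0 T 0 0 * fromBlocks A₁ 0 0 A₂ := by
  rw [Matrix.fromBlocks_multiply, Matrix.fromBlocks_multiply]
  simp [h]

/-- `H₀ = diag(1, -1)` is a non-zero trace-free `2 × 2` matrix. [folklore] -/
private theorem H₀_ne_zero₁₃₃ {K : Type*} [Field K] : (!![(1 : K), 0; 0, -1]) ≠ 0 := by
  intro h
  have h' := congrFun (congrFun h 0) 0
  simp at h'

end Helpers

variable {ι₁ ι₂ : Type*} [Fintype ι₁] [DecidableEq ι₁] [Fintype ι₂] [DecidableEq ι₂]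
  {E₁ E₂ : Type*} [NormedAddCommGroup E₁] [NormedSpace ℂ E₁] [NormedAddCommGroup E₂] [NormedSpace ℂ E₂]
  (Φ₁ : (ι₁ → ℝ) ≃L[ℝ] E₁) (Φ₂ : (ι₂ → ℝ) ≃L[ℝ] E₂)

/-! ## §1 A non-zero `𝔤`-equivariant `V₁,ℂ → V₂,ℂ` gives `Hom_ℚ(X₁, X₂) ≠ 0` -/

/-- **«Some multiple of `φ` corresponds to an isogeny»**: a NON-ZERO matrix `T : V₁,ℂ → V₂,ℂ` with `Z₂₂ T = T Z₁₁` for every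
`Z = (Z₁₁ 0; 0 Z₂₂) ∈ Lie Hg(X₁ × X₂)(ℂ)` forces `Hom_ℚ(X₁, X₂) ≠ 0` — `(0 0; T 0)` commutes with `𝔤`, so lies in
`End(V_ℂ)^𝔤 = End_ℚ(X₁ × X₂) ⊗_ℚ ℂ`, whose lower-left blocks are spanned by `Hom_ℚ(X₁, X₂) ⊗ 1` (any complex tori `X₁`, `X₂`).
[cite: MoonenZarhin1999LowDim, §3 proof of Lemma (3.3) (p0006 L126–L129) and Lemma (3.4)] [cite: Lange2023AbelianVarietiesComplex, §7.2.4 Exercise (3) and §1.1.2 Prop. 1.1.6] -/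
theorem homRat_ne_bot_of_forall_toBlocks₂₂_mul_eq {T : Matrix ι₂ ι₁ ℂ} (hT0 : T ≠ 0)
    (hT : ∀ Z ∈ lieAlgebraGL ((hodgeGroupC (prodPeriod Φ₁ Φ₂)).map Matrix.SpecialLinearGroup.toGL),
      Z.toBlocks₂₂ * T = T * Z.toBlocks₁₁) :
    homRat Φ₁ Φ₂ ≠ ⊥ := by
  intro h0
  have hYspan := (forall_hodgeGroupComplexLie_comm_iff_mem_span_endAlgRat (prodPeriod Φ₁ Φ₂)).1 (fun Z hZ ↦ by
    have hZ' := (mem_hodgeGroupComplexLie_iff_mem_lieAlgebraGL (prodPeriod Φ₁ Φ₂)).1 hZ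
    obtain ⟨hZeq, -, -⟩ := eq_fromBlocks_of_mem_lieAlgebraGL_hodgeGroupC_prod Φ₁ Φ₂ hZ'
    change Z * fromBlocks 0 0 T 0 = fromBlocks 0 0 T 0 * Z
    rw [hZeq]
    exact fromBlocks_diag_comm_lowerLeft₁₃₃ (hT Z hZ'))
  have hblocks : ∀ W ∈ Submodule.span ℂ ((fun A : Matrix (ι₁ ⊕ ι₂) (ι₁ ⊕ ι₂) ℚ ↦ A.map ((↑) : ℚ → ℂ)) ''
      (endAlgRat (prodPeriod Φ₁ Φ₂) : Set (Matrix (ι₁ ⊕ ι₂) (ι₁ ⊕ ι₂) ℚ))), W.toBlocks₂₁ = 0 := by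
    intro W hW
    induction hW using Submodule.span_induction with
    | mem x hx =>
      obtain ⟨A, hA, rfl⟩ := hx
      obtain ⟨-, -, h₂₁, -⟩ := (mem_endAlgRat_prod_iff Φ₁ Φ₂ A).1 hA
      rw [h0, Submodule.mem_bot] at h₂₁
      change A.toBlocks₂₁.map ((↑) : ℚ → ℂ) = 0
      rw [h₂₁, Matrix.map_zero _ Rat.cast_zero]
    | zero => rfl
    | add x y _ _ hx hy =>
      change x.toBlocks₂₁ + y.toBlocks₂₁ = 0
      rw [hx, hy, add_zero]
    | smul a x _ hx =>
      change a • x.toBlocks₂₁ = 0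
      rw [hx, smul_zero]
  have h := hblocks _ hYspan
  rw [Matrix.toBlocks_fromBlocks₂₁] at h
  exact hT0 h

/-- The mirror: a non-zero `T' : V₂,ℂ → V₁,ℂ` with `Z₁₁ T' = T' Z₂₂` on `Lie Hg(X₁ × X₂)(ℂ)` forces `Hom_ℚ(X₂, X₁) ≠ 0`.
[cite: MoonenZarhin1999LowDim, §3 proof of Lemma (3.3) and Lemma (3.4)] [cite: Lange2023AbelianVarietiesComplex, §7.2.4 Exercise (3)] -/
theorem homRat_ne_bot_of_forall_toBlocks₁₁_mul_eq {T : Matrix ι₁ ι₂ ℂ} (hT0 : T ≠ 0)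
    (hT : ∀ Z ∈ lieAlgebraGL ((hodgeGroupC (prodPeriod Φ₁ Φ₂)).map Matrix.SpecialLinearGroup.toGL),
      Z.toBlocks₁₁ * T = T * Z.toBlocks₂₂) :
    homRat Φ₂ Φ₁ ≠ ⊥ := by
  intro h0
  have hYspan := (forall_hodgeGroupComplexLie_comm_iff_mem_span_endAlgRat (prodPeriod Φ₁ Φ₂)).1 (fun Z hZ ↦ by
    have hZ' := (mem_hodgeGroupComplexLie_iff_mem_lieAlgebraGL (prodPeriod Φ₁ Φ₂)).1 hZ
    obtain ⟨hZeq, -, -⟩ := eq_fromBlocks_of_mem_lieAlgebraGL_hodgeGroupC_prod Φ₁ Φ₂ hZ'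
    change Z * fromBlocks 0 T 0 0 = fromBlocks 0 T 0 0 * Z
    rw [hZeq]
    exact fromBlocks_diag_comm_upperRight₁₃₃ (hT Z hZ'))
  have hblocks : ∀ W ∈ Submodule.span ℂ ((fun A : Matrix (ι₁ ⊕ ι₂) (ι₁ ⊕ ι₂) ℚ ↦ A.map ((↑) : ℚ → ℂ)) ''
      (endAlgRat (prodPeriod Φ₁ Φ₂) : Set (Matrix (ι₁ ⊕ ι₂) (ι₁ ⊕ ι₂) ℚ))), W.toBlocks₁₂ = 0 := by
    intro W hW
    induction hW using Submodule.span_induction with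
    | mem x hx =>
      obtain ⟨A, hA, rfl⟩ := hx
      obtain ⟨-, h₁₂, -, -⟩ := (mem_endAlgRat_prod_iff Φ₁ Φ₂ A).1 hA
      rw [h0, Submodule.mem_bot] at h₁₂
      change A.toBlocks₁₂.map ((↑) : ℚ → ℂ) = 0
      rw [h₁₂, Matrix.map_zero _ Rat.cast_zero]
    | zero => rfl
    | add x y _ _ hx hy =>
      change x.toBlocks₁₂ + y.toBlocks₁₂ = 0
      rw [hx, hy, add_zero]
    | smul a x _ hx =>
      change a • x.toBlocks₁₂ = 0
      rw [hx, smul_zero]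
  have h := hblocks _ hYspan
  rw [Matrix.toBlocks_fromBlocks₁₂] at h
  exact hT0 h

/-! ## §2 Splitting is tested on `Lie Hg(X₁)(ℂ)`: `(W 0; 0 0) ∈ 𝔤` for all `W ∈ 𝔤₁` ⟹ `Hg(X₁ × X₂) = Hg(X₁) × Hg(X₂)` -/

/-- **`(W 0; 0 0) ∈ Lie Hg(X₁ × X₂)(ℂ)` for every `W ∈ Lie Hg(X₁)(ℂ)` ⟹ `Hg(X₁ × X₂)(ℂ) = Hg(X₁)(ℂ) × Hg(X₂)(ℂ)`** (then `Lie K₁ =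
Lie Hg(X₁)(ℂ)`, `dim K₁° = dim Hg(X₁)`, and the tree's dimension criterion applies; «`𝔤₁ = 𝔥𝔤(X₁)`, i.e. `𝔤₃ = 0`»).
[cite: MoonenZarhin1999LowDim, §3 (3.1) (p0006 L25–L51)] [cite: Gordon1997, §2.16 Proposition] -/
theorem hodgeGroupC_prod_eq_blockDiagProd_of_forall_fromBlocks_zero_mem
    (h : ∀ W ∈ lieAlgebraGL ((hodgeGroupC Φ₁).map Matrix.SpecialLinearGroup.toGL),
      fromBlocks W 0 0 (0 : Matrix ι₂ ι₂ ℂ) ∈ lieAlgebraGL ((hodgeGroupC (prodPeriod Φ₁ Φ₂)).map Matrix.SpecialLinearGroup.toGL)) :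
    hodgeGroupC (prodPeriod Φ₁ Φ₂) = blockDiagProd (hodgeGroupC Φ₁) (hodgeGroupC Φ₂) := by
  have hK : lieAlgebraGL ((hodgeGroupCProdInl Φ₁ Φ₂).map Matrix.SpecialLinearGroup.toGL) =
      lieAlgebraGL ((hodgeGroupC Φ₁).map Matrix.SpecialLinearGroup.toGL) :=
    le_antisymm (lieAlgebraGL_hodgeGroupCProdInl_le Φ₁ Φ₂)
      fun W hW ↦ (fromBlocks_mem_lieAlgebraGL_hodgeGroupC_prod_zero_iff Φ₁ Φ₂).1 (h W hW)
  rw [hodgeGroupC_prod_eq_blockDiagProd_iff_zdim_identityComponent_hodgeGroupCProdInl_eq,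
    ← (isZConnected_identityComponent (isAlgebraicSubgroup_map_toGL_hodgeGroupCProdInl Φ₁ Φ₂)).finrank_lieAlgebraGL_eq.2,
    ← (isZConnected_map_toGL_hodgeGroupC Φ₁).finrank_lieAlgebraGL_eq.2,
    lieAlgebraGL_identityComponent (isAlgebraicSubgroup_map_toGL_hodgeGroupCProdInl Φ₁ Φ₂), hK]

/-! ## §3 The dichotomy from `𝔰𝔩₂`-plane data on both factors -/

variable {Φ₁ Φ₂} in
/-- **MOONEN–ZARHIN (3.1)∕(3.4) FOR `𝔰𝔩₂`-ISOTYPIC FACTORS, MATRIX FORM.**  Let `X₁`, `X₂` be complex tori whose complex Hodge Lie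
algebras `𝔤ₖ = Lie Hg(Xₖ)(ℂ)` come with finitely many planes in coordinates `P_U ∈ M_{ι×2}(ℂ)`, `Q_U ∈ M_{2×ι}(ℂ)` (`U ∈ sₖ`) such that
`Q_U P_U = 1`; every `Z ∈ 𝔤ₖ` satisfies `Z P_U = P_U ρ_U(Z)` and `Q_U Z = ρ_U(Z) Q_U` with `ρ_U(Z) = Q_U Z P_U` trace-free (a stable
plane with a stable complement, traceless action); `(ρ_U)_U : 𝔤ₖ → ∏ 𝔰𝔩₂` is ONTO and INJECTIVE.  Then EITHER
`Hg(X₁ × X₂)(ℂ) = Hg(X₁)(ℂ) × Hg(X₂)(ℂ)`, OR `Hom_ℚ(X₁, X₂) ≠ 0`, OR `Hom_ℚ(X₂, X₁) ≠ 0` (a cross pair of planes with comparable kernels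
gives a non-zero equivariant `P_{U'} g Q_U`; otherwise Goursat puts `𝔤₁ × 0 ⊆ 𝔤`).
[cite: MoonenZarhin1999LowDim, §3 (3.1), Thm. (3.2)(1), proof of Lemma (3.3) (p0006 L110–L129), Lemma (3.4)]
[cite: Jacobson1962LieAlgebras, Ch. IX §5 Thm. 5] [cite: Bourbaki2008LieGroups79, Ch. I §1 no. 8, Cor. 1 of Prop. 7] -/
theorem hodgeGroupC_prod_eq_blockDiagProd_or_homRat_ne_bot_of_sl2Planes {s₁ s₂ : Type*} [Fintype s₁] [Fintype s₂]
    [DecidableEq s₁] [DecidableEq s₂]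
    (P₁ : s₁ → Matrix ι₁ (Fin 2) ℂ) (Q₁ : s₁ → Matrix (Fin 2) ι₁ ℂ) (P₂ : s₂ → Matrix ι₂ (Fin 2) ℂ) (Q₂ : s₂ → Matrix (Fin 2) ι₂ ℂ)
    (hQP₁ : ∀ a, Q₁ a * P₁ a = 1) (hQP₂ : ∀ b, Q₂ b * P₂ b = 1)
    (hst₁ : ∀ a, ∀ Z ∈ lieAlgebraGL ((hodgeGroupC Φ₁).map Matrix.SpecialLinearGroup.toGL),
      Z * P₁ a = P₁ a * (Q₁ a * Z * P₁ a) ∧ Q₁ a * Z = Q₁ a * Z * P₁ a * Q₁ a)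
    (hst₂ : ∀ b, ∀ Z ∈ lieAlgebraGL ((hodgeGroupC Φ₂).map Matrix.SpecialLinearGroup.toGL),
      Z * P₂ b = P₂ b * (Q₂ b * Z * P₂ b) ∧ Q₂ b * Z = Q₂ b * Z * P₂ b * Q₂ b)
    (htr₁ : ∀ a, ∀ Z ∈ lieAlgebraGL ((hodgeGroupC Φ₁).map Matrix.SpecialLinearGroup.toGL), (Q₁ a * Z * P₁ a).trace = 0)
    (htr₂ : ∀ b, ∀ Z ∈ lieAlgebraGL ((hodgeGroupC Φ₂).map Matrix.SpecialLinearGroup.toGL), (Q₂ b * Z * P₂ b).trace = 0)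
    (hsurj₁ : ∀ X : s₁ → Matrix (Fin 2) (Fin 2) ℂ, (∀ a, (X a).trace = 0) →
      ∃ Z ∈ lieAlgebraGL ((hodgeGroupC Φ₁).map Matrix.SpecialLinearGroup.toGL), ∀ a, Q₁ a * Z * P₁ a = X a)
    (hsurj₂ : ∀ X : s₂ → Matrix (Fin 2) (Fin 2) ℂ, (∀ b, (X b).trace = 0) →
      ∃ Z ∈ lieAlgebraGL ((hodgeGroupC Φ₂).map Matrix.SpecialLinearGroup.toGL), ∀ b, Q₂ b * Z * P₂ b = X b)
    (hinj₁ : ∀ Z ∈ lieAlgebraGL ((hodgeGroupC Φ₁).map Matrix.SpecialLinearGroup.toGL), (∀ a, Q₁ a * Z * P₁ a = 0) → Z = 0)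
    (hinj₂ : ∀ Z ∈ lieAlgebraGL ((hodgeGroupC Φ₂).map Matrix.SpecialLinearGroup.toGL), (∀ b, Q₂ b * Z * P₂ b = 0) → Z = 0) :
    hodgeGroupC (prodPeriod Φ₁ Φ₂) = blockDiagProd (hodgeGroupC Φ₁) (hodgeGroupC Φ₂) ∨ homRat Φ₁ Φ₂ ≠ ⊥ ∨ homRat Φ₂ Φ₁ ≠ ⊥ := by
  classical
  set G := lieAlgebraGL ((hodgeGroupC (prodPeriod Φ₁ Φ₂)).map Matrix.SpecialLinearGroup.toGL) with hGdef
  -- the block readings `ρ_{(1,a)}(Z) = Q₁a Z₁₁ P₁a`, `ρ_{(2,b)}(Z) = Q₂b Z₂₂ P₂b` as linear maps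
  have mk₁ : ∀ a : s₁, ∃ r : Matrix (ι₁ ⊕ ι₂) (ι₁ ⊕ ι₂) ℂ →ₗ[ℂ] Matrix (Fin 2) (Fin 2) ℂ,
      ∀ Z, r Z = Q₁ a * Z.toBlocks₁₁ * P₁ a := fun a ↦
    ⟨{ toFun := fun Z ↦ Q₁ a * Z.toBlocks₁₁ * P₁ a
       map_add' := fun Z W ↦ by
         change Q₁ a * (Z.toBlocks₁₁ + W.toBlocks₁₁) * P₁ a = _
         rw [Matrix.mul_add, Matrix.add_mul]
       map_smul' := fun c Z ↦ by
         change Q₁ a * (c • Z.toBlocks₁₁) * P₁ a = c • (Q₁ a * Z.toBlocks₁₁ * P₁ a)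
         rw [Matrix.mul_smul, Matrix.smul_mul] }, fun Z ↦ rfl⟩
  have mk₂ : ∀ b : s₂, ∃ r : Matrix (ι₁ ⊕ ι₂) (ι₁ ⊕ ι₂) ℂ →ₗ[ℂ] Matrix (Fin 2) (Fin 2) ℂ,
      ∀ Z, r Z = Q₂ b * Z.toBlocks₂₂ * P₂ b := fun b ↦
    ⟨{ toFun := fun Z ↦ Q₂ b * Z.toBlocks₂₂ * P₂ b
       map_add' := fun Z W ↦ by
         change Q₂ b * (Z.toBlocks₂₂ + W.toBlocks₂₂) * P₂ b = _
         rw [Matrix.mul_add, Matrix.add_mul]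
       map_smul' := fun c Z ↦ by
         change Q₂ b * (c • Z.toBlocks₂₂) * P₂ b = c • (Q₂ b * Z.toBlocks₂₂ * P₂ b)
         rw [Matrix.mul_smul, Matrix.smul_mul] }, fun Z ↦ rfl⟩
  choose r₁ hr₁ using mk₁
  choose r₂ hr₂ using mk₂
  set ρ : s₁ ⊕ s₂ → Matrix (ι₁ ⊕ ι₂) (ι₁ ⊕ ι₂) ℂ →ₗ[ℂ] Matrix (Fin 2) (Fin 2) ℂ := Sum.elim r₁ r₂ with hρdef
  have hρ₁ : ∀ a Z, ρ (Sum.inl a) Z = Q₁ a * Z.toBlocks₁₁ * P₁ a := fun a Z ↦ by rw [hρdef, Sum.elim_inl, hr₁]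
  have hρ₂ : ∀ b Z, ρ (Sum.inr b) Z = Q₂ b * Z.toBlocks₂₂ * P₂ b := fun b Z ↦ by rw [hρdef, Sum.elim_inr, hr₂]
  -- (i) brackets lift simultaneously
  have hbr : ∀ A ∈ G, ∀ B ∈ G, ∃ C ∈ G, ∀ i, ρ i C = ρ i A * ρ i B - ρ i B * ρ i A := by
    intro A hA B hB
    obtain ⟨hAeq, hA₁, hA₂⟩ := eq_fromBlocks_of_mem_lieAlgebraGL_hodgeGroupC_prod Φ₁ Φ₂ hA
    obtain ⟨hBeq, hB₁, hB₂⟩ := eq_fromBlocks_of_mem_lieAlgebraGL_hodgeGroupC_prod Φ₁ Φ₂ hB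
    obtain ⟨h₁₁, h₂₂⟩ := toBlocks_diag_bracket₁₃₃ hAeq hBeq
    refine ⟨A * B - B * A, lie_mem_lieAlgebraGL hA hB, ?_⟩
    rintro (a | b)
    · rw [hρ₁, hρ₁, hρ₁, h₁₁, conj_bracket_of_stable₁₃₃ (hst₁ a _ hA₁).1 (hst₁ a _ hB₁).1]
    · rw [hρ₂, hρ₂, hρ₂, h₂₂, conj_bracket_of_stable₁₃₃ (hst₂ b _ hA₂).1 (hst₂ b _ hB₂).1]
  -- (ii) trace-free values
  have htr : ∀ i, ∀ A ∈ G, (ρ i A).trace = 0 := by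
    rintro (a | b) A hA
    · rw [hρ₁]
      exact htr₁ a _ (eq_fromBlocks_of_mem_lieAlgebraGL_hodgeGroupC_prod Φ₁ Φ₂ hA).2.1
    · rw [hρ₂]
      exact htr₂ b _ (eq_fromBlocks_of_mem_lieAlgebraGL_hodgeGroupC_prod Φ₁ Φ₂ hA).2.2
  -- (iii) each `ρ i` is onto `𝔰𝔩₂`, with prescribed values on the other planes of the same factor
  obtain ⟨f, g, hf, hg, hfs, hgs, -⟩ := exists_lieHom_toBlocks Φ₁ Φ₂
  have hlift₁ : ∀ X : s₁ → Matrix (Fin 2) (Fin 2) ℂ, (∀ a, (X a).trace = 0) → ∃ A ∈ G, ∀ a, ρ (Sum.inl a) A = X a := by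
    intro X hX
    obtain ⟨W, hW, hWX⟩ := hsurj₁ X hX
    obtain ⟨Z, hZ⟩ := hfs ⟨W, hW⟩
    have hZ₁ : (Z : Matrix (ι₁ ⊕ ι₂) (ι₁ ⊕ ι₂) ℂ).toBlocks₁₁ = W := by rw [← hf Z, hZ]
    exact ⟨(Z : Matrix (ι₁ ⊕ ι₂) (ι₁ ⊕ ι₂) ℂ), Z.2, fun a ↦ by rw [hρ₁, hZ₁, hWX]⟩
  have hlift₂ : ∀ X : s₂ → Matrix (Fin 2) (Fin 2) ℂ, (∀ b, (X b).trace = 0) → ∃ A ∈ G, ∀ b, ρ (Sum.inr b) A = X b := by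
    intro X hX
    obtain ⟨W, hW, hWX⟩ := hsurj₂ X hX
    obtain ⟨Z, hZ⟩ := hgs ⟨W, hW⟩
    have hZ₂ : (Z : Matrix (ι₁ ⊕ ι₂) (ι₁ ⊕ ι₂) ℂ).toBlocks₂₂ = W := by rw [← hg Z, hZ]
    exact ⟨(Z : Matrix (ι₁ ⊕ ι₂) (ι₁ ⊕ ι₂) ℂ), Z.2, fun b ↦ by rw [hρ₂, hZ₂, hWX]⟩
  have hs : ∀ i, ∀ X : Matrix (Fin 2) (Fin 2) ℂ, X.trace = 0 → ∃ A ∈ G, ρ i A = X := by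
    rintro (a | b) X hX
    · obtain ⟨A, hA, h⟩ := hlift₁ (fun _ ↦ X) (fun _ ↦ hX)
      exact ⟨A, hA, h a⟩
    · obtain ⟨A, hA, h⟩ := hlift₂ (fun _ ↦ X) (fun _ ↦ hX)
      exact ⟨A, hA, h b⟩
  -- same-factor planes have incomparable kernels
  have hne₁ : ∀ a a' : s₁, a ≠ a' → ∃ A ∈ G, ρ (Sum.inl a) A = 0 ∧ ρ (Sum.inl a') A ≠ 0 := by
    intro a a' haa'
    obtain ⟨A, hA, h⟩ := hlift₁ (fun c ↦ if c = a then 0 else !![(1 : ℂ), 0; 0, -1])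
      (fun c ↦ by split_ifs <;> simp [Matrix.trace_fin_two])
    refine ⟨A, hA, by rw [h, if_pos rfl], ?_⟩
    rw [h, if_neg (Ne.symm haa')]
    exact H₀_ne_zero₁₃₃
  have hne₂ : ∀ b b' : s₂, b ≠ b' → ∃ A ∈ G, ρ (Sum.inr b) A = 0 ∧ ρ (Sum.inr b') A ≠ 0 := by
    intro b b' hbb'
    obtain ⟨A, hA, h⟩ := hlift₂ (fun c ↦ if c = b then 0 else !![(1 : ℂ), 0; 0, -1])
      (fun c ↦ by split_ifs <;> simp [Matrix.trace_fin_two])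
    refine ⟨A, hA, by rw [h, if_pos rfl], ?_⟩
    rw [h, if_neg (Ne.symm hbb')]
    exact H₀_ne_zero₁₃₃
  -- THE DICHOTOMY
  by_cases hcross : ∃ a b, (∀ A ∈ G, ρ (Sum.inl a) A = 0 → ρ (Sum.inr b) A = 0) ∨
      (∀ A ∈ G, ρ (Sum.inr b) A = 0 → ρ (Sum.inl a) A = 0)
  · -- a cross pair with comparable kernels: a non-zero equivariant map
    obtain ⟨a, b, hab | hba⟩ := hcross
    · have hbr' : ∀ A ∈ G, ∀ B ∈ G, ∃ C ∈ G, ρ (Sum.inl a) C = ρ (Sum.inl a) A * ρ (Sum.inl a) B - ρ (Sum.inl a) B * ρ (Sum.inl a) A ∧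
          ρ (Sum.inr b) C = ρ (Sum.inr b) A * ρ (Sum.inr b) B - ρ (Sum.inr b) B * ρ (Sum.inr b) A := fun A hA B hB ↦ by
        obtain ⟨C, hC, h⟩ := hbr A hA B hB
        exact ⟨C, hC, h _, h _⟩
      obtain ⟨A₀, hA₀, hA₀H⟩ := hs (Sum.inr b) _ (show (!![(1 : ℂ), 0; 0, -1]).trace = 0 by simp [Matrix.trace_fin_two])
      obtain ⟨g₀, g₀', hgg', -, hint⟩ := Sl2Graph.exists_intertwiner_of_ker_le hbr' (htr (Sum.inl a)) (hs (Sum.inl a)) hab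
        ⟨A₀, hA₀, by rw [hA₀H]; exact H₀_ne_zero₁₃₃⟩
      refine Or.inr (Or.inl (homRat_ne_bot_of_forall_toBlocks₂₂_mul_eq Φ₁ Φ₂ (T := P₂ b * g₀ * Q₁ a) ?_ fun Z hZ ↦ ?_))
      · intro h0
        have h1 : g₀ = 0 := by
          calc g₀ = Q₂ b * P₂ b * g₀ * (Q₁ a * P₁ a) := by rw [hQP₂, hQP₁, Matrix.one_mul, Matrix.mul_one]
            _ = Q₂ b * (P₂ b * g₀ * Q₁ a) * P₁ a := by simp only [Matrix.mul_assoc]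
            _ = 0 := by rw [h0, Matrix.mul_zero, Matrix.zero_mul]
        rw [h1, Matrix.zero_mul] at hgg'
        exact H₀_ne_zero₁₃₃ (K := ℂ) (by
          have h := congrFun (congrFun hgg' 0) 0
          simp at h)
      · obtain ⟨-, hZ₁, hZ₂⟩ := eq_fromBlocks_of_mem_lieAlgebraGL_hodgeGroupC_prod Φ₁ Φ₂ hZ
        have hi := hint Z hZ
        rw [hρ₁, hρ₂] at hi
        calc Z.toBlocks₂₂ * (P₂ b * g₀ * Q₁ a) = Z.toBlocks₂₂ * P₂ b * g₀ * Q₁ a := by simp only [Matrix.mul_assoc]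
          _ = P₂ b * (Q₂ b * Z.toBlocks₂₂ * P₂ b * g₀) * Q₁ a := by rw [(hst₂ b _ hZ₂).1]; simp only [Matrix.mul_assoc]
          _ = P₂ b * (g₀ * (Q₁ a * Z.toBlocks₁₁ * P₁ a)) * Q₁ a := by rw [hi]
          _ = P₂ b * g₀ * (Q₁ a * Z.toBlocks₁₁ * P₁ a * Q₁ a) := by simp only [Matrix.mul_assoc]
          _ = P₂ b * g₀ * Q₁ a * Z.toBlocks₁₁ := by rw [← (hst₁ a _ hZ₁).2]; simp only [Matrix.mul_assoc]
    · have hbr' : ∀ A ∈ G, ∀ B ∈ G, ∃ C ∈ G, ρ (Sum.inr b) C = ρ (Sum.inr b) A * ρ (Sum.inr b) B - ρ (Sum.inr b) B * ρ (Sum.inr b) A ∧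
          ρ (Sum.inl a) C = ρ (Sum.inl a) A * ρ (Sum.inl a) B - ρ (Sum.inl a) B * ρ (Sum.inl a) A := fun A hA B hB ↦ by
        obtain ⟨C, hC, h⟩ := hbr A hA B hB
        exact ⟨C, hC, h _, h _⟩
      obtain ⟨A₀, hA₀, hA₀H⟩ := hs (Sum.inl a) _ (show (!![(1 : ℂ), 0; 0, -1]).trace = 0 by simp [Matrix.trace_fin_two])
      obtain ⟨g₀, g₀', hgg', -, hint⟩ := Sl2Graph.exists_intertwiner_of_ker_le hbr' (htr (Sum.inr b)) (hs (Sum.inr b)) hba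
        ⟨A₀, hA₀, by rw [hA₀H]; exact H₀_ne_zero₁₃₃⟩
      refine Or.inr (Or.inr (homRat_ne_bot_of_forall_toBlocks₁₁_mul_eq Φ₁ Φ₂ (T := P₁ a * g₀ * Q₂ b) ?_ fun Z hZ ↦ ?_))
      · intro h0
        have h1 : g₀ = 0 := by
          calc g₀ = Q₁ a * P₁ a * g₀ * (Q₂ b * P₂ b) := by rw [hQP₁, hQP₂, Matrix.one_mul, Matrix.mul_one]
            _ = Q₁ a * (P₁ a * g₀ * Q₂ b) * P₂ b := by simp only [Matrix.mul_assoc]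
            _ = 0 := by rw [h0, Matrix.mul_zero, Matrix.zero_mul]
        rw [h1, Matrix.zero_mul] at hgg'
        exact H₀_ne_zero₁₃₃ (K := ℂ) (by
          have h := congrFun (congrFun hgg' 0) 0
          simp at h)
      · obtain ⟨-, hZ₁, hZ₂⟩ := eq_fromBlocks_of_mem_lieAlgebraGL_hodgeGroupC_prod Φ₁ Φ₂ hZ
        have hi := hint Z hZ
        rw [hρ₁, hρ₂] at hi
        calc Z.toBlocks₁₁ * (P₁ a * g₀ * Q₂ b) = Z.toBlocks₁₁ * P₁ a * g₀ * Q₂ b := by simp only [Matrix.mul_assoc]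
          _ = P₁ a * (Q₁ a * Z.toBlocks₁₁ * P₁ a * g₀) * Q₂ b := by rw [(hst₁ a _ hZ₁).1]; simp only [Matrix.mul_assoc]
          _ = P₁ a * (g₀ * (Q₂ b * Z.toBlocks₂₂ * P₂ b)) * Q₂ b := by rw [hi]
          _ = P₁ a * g₀ * (Q₂ b * Z.toBlocks₂₂ * P₂ b * Q₂ b) := by simp only [Matrix.mul_assoc]
          _ = P₁ a * g₀ * Q₂ b * Z.toBlocks₂₂ := by rw [← (hst₂ b _ hZ₂).2]; simp only [Matrix.mul_assoc]
  · -- all cross pairs incomparable: Goursat puts `𝔤₁ × 0 ⊆ 𝔤`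
    push Not at hcross
    have hne : ∀ i j, i ≠ j → ∃ A ∈ G, ρ i A = 0 ∧ ρ j A ≠ 0 := by
      rintro (a | b) (a' | b') hij
      · exact hne₁ a a' fun h ↦ hij (by rw [h])
      · exact (hcross a b').1
      · exact (hcross a' b).2
      · exact hne₂ b b' fun h ↦ hij (by rw [h])
    refine Or.inl (hodgeGroupC_prod_eq_blockDiagProd_of_forall_fromBlocks_zero_mem Φ₁ Φ₂ fun W hW ↦ ?_)
    obtain ⟨A, hA, hAρ⟩ := Sl2Graph.forall_exists_apply_eq_of_pairwise_univ hbr htr hs hne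
      (Sum.elim (fun a ↦ Q₁ a * W * P₁ a) (fun _ ↦ 0))
      (by
        rintro (a | b)
        · exact htr₁ a W hW
        · simp)
    obtain ⟨hAeq, hA₁, hA₂⟩ := eq_fromBlocks_of_mem_lieAlgebraGL_hodgeGroupC_prod Φ₁ Φ₂ hA
    have h₂ : A.toBlocks₂₂ = 0 := hinj₂ _ hA₂ fun b ↦ by rw [← hρ₂, hAρ (Sum.inr b), Sum.elim_inr]
    have h₁ : A.toBlocks₁₁ = W := by
      rw [← sub_eq_zero]
      refine hinj₁ _ (Submodule.sub_mem _ hA₁ hW) fun a ↦ ?_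
      rw [Matrix.mul_sub, Matrix.sub_mul, ← hρ₁, hAρ (Sum.inl a), Sum.elim_inl, sub_self]
    rw [hAeq, h₁, h₂] at hA
    exact hA

end ComplexTorus

end Literature.Geometry.Kaehler
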